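import Summits.HodgeConjecture.HodgeConjecture.Theorems.MarkmanPartnerTransportPartnerExistenceOfRatTranscIsometry
import Summits.HodgeConjecture.HodgeConjecture.Theorems.MarkmanPartnerTransportPartnerTransportTranscendental

/-!
# Route MarkmanPartnerTransport · support `PartnerExistence` (stmt-HodgeConjecture-19655) and crux
# `LowPicardRealMultiplication` (#5) — X3a: A K3 PARTNER FROM A RATIONAL NÉRON–SEVERI CLASS OF SQUARE `−2`
# (Hasse–Minkowski-free, every Picard rank)

Memo ROUTE-P1AI §D3′ (p1 g36): for a `K3^{[2]}`-type fourfold `X` with `H²(X,ℚ) ≅ Λ_ℚ ⊕ ⟨−2⟩`,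
`T := T(X)_ℚ`, `N := NS(X)_ℚ`, **`T` embeds isometrically into `Λ_ℚ` iff `N` represents `−2`**; the partner
construction of the route (`PartnerExistence`, item #9, proved by 19652-p1 g5 for `ρ(X) ≥ 4` modulo
Hasse–Minkowski + the surjectivity of the period map) splits accordingly into the provable X3a and the honest
residue X3b («ternary `N` not representing `−2`»: no partner, no common smooth model with a Hilbert square).

* §1 `qQ_eq_k3FormRat_sub`, `qQ_single_inr` — the rational `K3^{[2]}` form in `ℚ²³ = Λ_ℚ ⊕ ℚδ`;
* §2 `exists_reflection` (reflections of `(ℚ²³, q)`), **`exists_ratTransc_isometry_of_minusTwo`** — the WITT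
  STEP: `v ∈ N_ℚ`, `q(v) = −2` ⇒ an injective isometry `(T_ℚ, q) →qᵢ (ℚ²², k3FormRat)` (ONE reflection `s_{v∓δ}`
  carries `v` to `±δ`, hence `T_ℚ` into `δ^⊥ = Λ_ℚ`; no Witt-cancellation library, no Hasse–Minkowski);
* §3 **`exists_k3Partner_of_minusTwoClass`** — X3a: marked `(X, φ, P, z)`, `v ∈ N¹(X)` rational with `q(φ v) = −2`
  ⇒ a projective K3 partner `(S, η, p, x, g)` with (g1)–(g7) and `ρ(X) ≤ ρ(S) + 1`, mod
  `Huybrechts_K3_periodSurjective_projective` (via `partnerExistence_of_ratTransc_isometry`);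
  `exists_k3Partner_of_markedHilbertSquare` — non-vacuity: every fourfold marked with period `(x, 0)` (Beauville's
  marked Hilbert squares) has `v = δ`;
* (sibling file `…PartnerOfMinusTwoClassHodge`, which imports the route's `PartnerTransport` proof and hence its
  Theses cone) `hodgeConjectureFor_of_minusTwoClass_of_partnerSquares` — HC⁴(X) ⟸ HC⁴(S ⊗ S) for the K3 partners:
  the `X`-side of every K3-side rung for `X` whose `NS(X)_ℚ` represents `−2`, in particular at `ρ(X) = 3`.

CONDITIONAL (facts displayed); no definition, no sorry, no new named fact; credits nothing; crux #5 and HC stay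
open. Prover seat hodge-nonav-19716-p2 (gen 4), `--supports stmt-HodgeConjecture-19655`.

References: J.-P. Serre, *A Course in Arithmetic*, Ch. IV §1.5 Thm. 3 (Witt); A. Beauville, J. Differential
Geom. 18 (1983) §6, §9; D. Huybrechts, *Lectures on K3 Surfaces*, Ch. 6 Thm. 3.1, Ch. 7 Thm. 4.1; E. Markman,
Compos. Math. 160 (2024) Thm. 1.1, 1.4; D. Morrison, Invent. Math. 75 (1984) §1–2.
-/

noncomputable section

set_option linter.dupNamespace false

open scoped Matrix
open Module CategoryTheory MonoidalCategory
open Literature.AlgebraicTopology.SingularHomology Literature.Geometry.Kaehler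
open Literature.AlgebraicGeometry Literature.AlgebraicGeometry.Motives Literature.AlgebraicGeometry.HodgeTheory
open Literature.AlgebraicGeometry.Hyperkaehler Literature.AlgebraicGeometry.Surfaces
open Summit.HodgeConjecture.HodgeConjecture.Theorems.NikulinTwinTransport
open Summit.HodgeConjecture.HodgeConjecture.Theorems.MarkmanPartnerTransport.BBFPositivity

namespace Summit.HodgeConjecture.HodgeConjecture.Theorems.MarkmanPartnerTransport.PartnerLattice

/-- `MarkedK3Sq[X, φ, P, z]`: VERBATIM the `let MarkedK3Sq := …` binder of the route declarations of
MarkmanPartnerTransport (clauses (m1)–(m6)). Local notation only. -/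
local notation3 (prettyPrint := false) "MarkedK3Sq[" X ", " φ ", " P ", " z "]" =>
  (((IsIntegralClass P ∧ ∀ Q : complexBetti X (2 * 4), IsIntegralClass Q → ∃ n : ℤ, Q = n • P) ∧
    (∀ c : complexBetti X 2, IsIntegralClass c ↔ ∃ v : K3HilbertIndex → ℤ, φ c = fun i => (v i : ℂ)) ∧
    (∀ a : complexBetti X 2, cupPowTwo a 4 = ((3 : ℂ) * (k3HilbertForm 2 (φ a) (φ a)) ^ 2) • P) ∧
    (IsOfHodgeType 4 X 2 2 0 (LinearEquiv.symm φ z) ∧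
      ∀ τ : complexBetti X 2, IsOfHodgeType 4 X 2 2 0 τ → ∃ t : ℂ, τ = t • LinearEquiv.symm φ z) ∧
    (∀ c : complexBetti X 2, IsOfHodgeType 4 X 2 1 1 c ↔
      (k3HilbertForm 2 (φ c) z = 0 ∧ k3HilbertForm 2 (φ c) (star z) = 0)) ∧
    (k3HilbertForm 2 z z = 0 ∧ 0 < (k3HilbertForm 2 (star z) z).re)))

/-- `qQ` = the rational Beauville–Bogomolov form of `K3^{[2]}`-type on `ℚ²³`. Local notation only. -/
local notation3 (prettyPrint := false) "qQ" => Matrix.toBilin' (Matrix.map (k3HilbertGram 2) (Int.cast : ℤ → ℚ))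

/-! ### §1 The rational `K3^{[2]}` form in the splitting `ℚ²³ = Λ_ℚ ⊕ ℚδ` -/

/-- `q(w, w') = (w|_{Λ} · w'|_{Λ}) − 2 w_δ w'_δ`: the rational `K3^{[2]}` form is the K3 form of the
`Λ_{K3}`-parts plus the `⟨−2⟩` block. [cite: Beauville1983, §9 Lemme 1 and Rem. 1] -/
theorem qQ_eq_k3FormRat_sub (w w' : K3HilbertIndex → ℚ) :
    qQ w w' = k3FormRat (fun k => w (Sum.inl k)) (fun k => w' (Sum.inl k)) - 2 * (w (Sum.inr ()) * w' (Sum.inr ())) := by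
  rw [Matrix.toBilin'_apply, k3FormRat_apply]
  simp only [Fintype.sum_sum_type, Matrix.map_apply, k3HilbertGram_inl_inl, k3HilbertGram_inl_inr,
    k3HilbertGram_inr_inl, k3HilbertGram_two_inr_inr, Int.cast_zero, mul_zero, zero_mul, Finset.sum_const_zero,
    add_zero, zero_add, Finset.univ_unique, Finset.sum_singleton, PUnit.default_eq_unit, Int.cast_neg,
    Int.cast_ofNat]
  ring

/-- `q(w, δ) = −2 w_δ` for `δ = e_{inr}`. [cite: Beauville1983, §9 Rem. 1] -/
theorem qQ_single_inr (w : K3HilbertIndex → ℚ) :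
    qQ w (Pi.single (Sum.inr ()) 1) = -2 * w (Sum.inr ()) := by
  rw [qQ_eq_k3FormRat_sub]
  have h0 : (fun k : K3Index => (Pi.single (Sum.inr ()) (1 : ℚ) : K3HilbertIndex → ℚ) (Sum.inl k)) = 0 := by
    funext k; simp
  rw [h0, LinearMap.map_zero]
  simp

/-! ### §2 One reflection: a rational Néron–Severi vector of square `−2` moves to `δ` -/

/-- **Reflections of `(ℚ²³, q)`**: for `q(u) ≠ 0`, `s_u(w) = w − (2 q(w,u) / q(u)) u` is a `q`-isometry.
[cite: Serre1973, Ch. IV §1.5] -/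
theorem exists_reflection (u : K3HilbertIndex → ℚ) (hu : qQ u u ≠ 0) :
    ∃ s : (K3HilbertIndex → ℚ) →ₗ[ℚ] (K3HilbertIndex → ℚ),
      (∀ a b, qQ (s a) (s b) = qQ a b) ∧ ∀ w, s w = w - ((2 * qQ w u) / qQ u u) • u := by
  refine ⟨LinearMap.id - ((2 / qQ u u) • (LinearMap.flip qQ u).smulRight u), fun a b => ?_, fun w => ?_⟩
  · simp only [LinearMap.sub_apply, LinearMap.id_apply, LinearMap.smul_apply, LinearMap.smulRight_apply,
      LinearMap.flip_apply, map_sub, map_smul, smul_eq_mul, LinearMap.sub_apply, LinearMap.smul_apply]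
    rw [qQ_comm u b]
    field_simp
    ring
  · simp only [LinearMap.sub_apply, LinearMap.id_apply, LinearMap.smul_apply, LinearMap.smulRight_apply,
      LinearMap.flip_apply, smul_smul]
    congr 1
    rw [div_mul_eq_mul_div, mul_comm]

/-- **The Witt step (Hasse–Minkowski-free).** If the rational subspace `NQ ⊂ ℚ²³` contains a vector `v` with
`q(v) = −2`, then the `q`-orthogonal `T_ℚ = NQ^⊥` embeds ISOMETRICALLY and injectively into
`(ℚ²², k3FormRat) = Λ_{K3} ⊗ ℚ`: ONE reflection `s_{v∓δ}` of `(ℚ²³, q)` (with `q(v − δ) ≠ 0`, or else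
`q(v + δ) = −8 ≠ 0`) carries `v` to `±δ`, hence `T_ℚ ⊥ v` into `δ^⊥ = Λ_ℚ ⊕ 0`; dropping the `δ`-coordinate is
then an isometry (the `δ`-block is orthogonal to `Λ_ℚ`). This is the shape consumed by
`partnerExistence_of_ratTransc_isometry`; cf. `exists_isometry_ratTransc` (Hasse–Minkowski, `ρ(X) ≥ 4`).
[cite: Serre1973, Ch. IV §1.5 Thm. 3] [cite: Beauville1983, §9 Lemme 1 and Rem. 1] -/
theorem exists_ratTransc_isometry_of_minusTwo {NQ : Submodule ℚ (K3HilbertIndex → ℚ)}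
    {v : K3HilbertIndex → ℚ} (hvN : v ∈ NQ) (hv : qQ v v = -2) :
    ∃ f : ((qQ).restrict ((qQ).orthogonal NQ)).toQuadraticMap →qᵢ k3FormRat.toQuadraticMap,
      Function.Injective f := by
  set δ : K3HilbertIndex → ℚ := Pi.single (Sum.inr ()) 1 with hδdef
  have hδδ : qQ δ δ = -2 := by rw [hδdef, qQ_single_inr]; simp
  have hvδ : qQ v δ = qQ δ v := qQ_comm v δ
  -- one reflection `s` with `s v = ε • δ`, `ε = ±1`
  obtain ⟨s, hs, ε, hsv⟩ : ∃ s : (K3HilbertIndex → ℚ) →ₗ[ℚ] (K3HilbertIndex → ℚ),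
      (∀ a b, qQ (s a) (s b) = qQ a b) ∧ ∃ ε : ℚ, s v = ε • δ := by
    by_cases h : qQ (v - δ) (v - δ) = 0
    · have h' : qQ (v + δ) (v + δ) ≠ 0 := by
        have hsum : qQ (v - δ) (v - δ) + qQ (v + δ) (v + δ) = -8 := by
          simp only [map_sub, map_add, LinearMap.sub_apply, LinearMap.add_apply, hv, hδδ, hvδ]
          ring
        rw [h, zero_add] at hsum
        rw [hsum]; norm_num
      obtain ⟨s, hs, hsw⟩ := exists_reflection (v + δ) h'
      refine ⟨s, hs, -1, ?_⟩
      have hc : 2 * qQ v (v + δ) / qQ (v + δ) (v + δ) = 1 := by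
        rw [div_eq_one_iff_eq h']
        simp only [map_add, LinearMap.add_apply, hv, hδδ, hvδ]
        ring
      rw [hsw, hc, one_smul, neg_one_smul]
      abel
    · obtain ⟨s, hs, hsw⟩ := exists_reflection (v - δ) h
      refine ⟨s, hs, 1, ?_⟩
      have hc : 2 * qQ v (v - δ) / qQ (v - δ) (v - δ) = 1 := by
        rw [div_eq_one_iff_eq h]
        simp only [map_sub, LinearMap.sub_apply, hv, hδδ, hvδ]
        ring
      rw [hsw, hc, one_smul, one_smul, sub_sub_cancel]
  -- `s(T_ℚ) ⊥ δ`: the `δ`-coordinate of `s t` vanishes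
  have hinr : ∀ t ∈ (qQ).orthogonal NQ, s t (Sum.inr ()) = 0 := by
    intro t ht
    have h1 : qQ (s t) (s v) = 0 := by
      rw [hs, qQ_comm]
      exact (LinearMap.BilinForm.mem_orthogonal_iff.1 ht) v hvN
    rw [hsv, map_smul, smul_eq_mul, hδdef, qQ_single_inr] at h1
    -- `ε ≠ 0`: `q(s v) = q(v) = -2 ≠ 0`
    have hε : ε ≠ 0 := by
      rintro rfl
      have h2 := hs v v
      rw [hv] at h2
      simp [hsv] at h2
    have : (-2 : ℚ) * s t (Sum.inr ()) = 0 := by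
      rcases mul_eq_zero.1 h1 with h | h
      · exact absurd h hε
      · exact h
    simpa using this
  -- the embedding: `t ↦ (s t)|_{Λ}`
  set L : (qQ).orthogonal NQ →ₗ[ℚ] (K3Index → ℚ) :=
    LinearMap.funLeft ℚ ℚ (Sum.inl : K3Index → K3HilbertIndex) ∘ₗ s ∘ₗ ((qQ).orthogonal NQ).subtype with hLdef
  have hL : ∀ t : (qQ).orthogonal NQ, L t = fun k => s t (Sum.inl k) := fun t => rfl
  have hLq : ∀ t t' : (qQ).orthogonal NQ, k3FormRat (L t) (L t') = qQ t t' := by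
    intro t t'
    rw [hL, hL, ← hs t t', qQ_eq_k3FormRat_sub, hinr _ t.2, hinr _ t'.2]
    ring
  refine ⟨{ toLinearMap := L, map_app' := fun t => ?_ }, fun t t' htt' => ?_⟩
  · rw [LinearMap.BilinMap.toQuadraticMap_apply, LinearMap.BilinMap.toQuadraticMap_apply]
    exact hLq t t
  · -- injectivity: `q` is non-degenerate on `ℚ²³` and `s`, `L` preserve it on `T_ℚ`… via `s t = s t'`
    change L t = L t' at htt'
    have hst : s t = s t' := by
      funext i
      rcases i with k | u
      · exact congrFun htt' k
      · obtain rfl : u = () := rfl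
        rw [hinr _ t.2, hinr _ t'.2]
    apply Subtype.ext
    have h0 : s ((t : K3HilbertIndex → ℚ) - t') = 0 := by rw [map_sub, hst, sub_self]
    have hzero : (t : K3HilbertIndex → ℚ) - t' = 0 := by
      refine qQ_nondegenerate.1 _ fun w => ?_
      rw [← hs, h0, LinearMap.map_zero, LinearMap.zero_apply]
    exact sub_eq_zero.1 hzero


/-! ### §3 X3a: a K3 partner from a rational Néron–Severi class of square `−2` -/

variable {X : SchemeOver ℂ} {φ : complexBetti X 2 ≃ₗ[ℂ] (K3HilbertIndex → ℂ)} {P : complexBetti X (2 * 4)}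
  {z : K3HilbertIndex → ℂ}

/-- **X3a — A `K3^{[2]}`-TYPE MARKED FOURFOLD WITH A RATIONAL ALGEBRAIC CLASS OF BEAUVILLE–BOGOMOLOV SQUARE
`−2` HAS A K3 PARTNER** (memo ROUTE-P1AI §D3′; Hasse–Minkowski-free, every Picard rank). For a marked smooth
projective fourfold `(X, φ, P, z)` and `v ∈ N¹(X)` rational with `q(φ v, φ v) = −2` there are a projective K3
surface `S`, a marking `(η, p, x)` (all clauses, incl. `(x̄·x) > 0` and a positive integral `u ⊥ x`) and
`g : H²(S) → H²(X)` with (g1)–(g7) of the route (rational; Hodge; kills `N¹(S)`; image in and onto `T(X)_ℂ`;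
isometry on `T(S)`; rational lifts) and `ρ(X) ≤ ρ(S) + 1` — modulo `Huybrechts_K3_periodSurjective_projective`
only. Proof: `exists_ratTransc_isometry_of_minusTwo` (one reflection) + `partnerExistence_of_ratTransc_isometry`.
The route's `PartnerExistence` (`ρ(X) ≥ 4`, p1 g5) is this with the `−2` supplied by Hasse–Minkowski; at
`ρ(X) = 3` (crux #5's range) «`NS(X)_ℚ` represents `−2`» is the honest, checkable hypothesis (it holds for
Hilbert squares, `v = δ`: `exists_k3Partner_of_markedHilbertSquare`).
[cite: Huybrechts2016K3, Ch. 6 Thm. 3.1 and Rem. 3.3; Ch. 7 Thm. 4.1] [cite: Serre1973, Ch. IV §1.5 Thm. 3]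
[cite: Beauville1983, §9 Lemme 1 and Rem. 1] [cite: Morrison1984, §1–2] -/
theorem exists_k3Partner_of_minusTwoClass (hP : Huybrechts_K3_periodSurjective_projective)
    (hX : IsSmoothProjective 4 X) (hM : MarkedK3Sq[X, φ, P, z]) {v : complexBetti X 2}
    (hv : v ∈ algebraicClasses X 1) (hvrat : IsRationalClass v) (hq : k3HilbertForm 2 (φ v) (φ v) = -2) :
    ∃ (S : SchemeOver ℂ) (η : complexBetti S (2 * 1) ≃ₗ[ℂ] (K3Index → ℂ)) (p : complexBetti S (2 * 2))
      (x : K3Index → ℂ) (g : complexBetti S (2 * 1) →ₗ[ℂ] complexBetti X 2),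
      IsK3Surface S ∧
      (p ≠ 0 ∧ (IsIntegralClass p ∧ (∀ q : complexBetti S (2 * 2), IsIntegralClass q → ∃ n : ℤ, q = n • p) ∧
        (∀ c : complexBetti S (2 * 1), IsIntegralClass c ↔ ∃ v : K3Index → ℤ, η c = fun i => (v i : ℂ)) ∧
        (∀ a b : complexBetti S (2 * 1), cupProduct (rfl : 2 * 1 + 2 * 1 = 2 * 2) a b = k3Form (η a) (η b) • p) ∧
        IsOfHodgeType 2 S (2 * 1) 2 0 (LinearEquiv.symm η x) ∧
        (∀ τ : complexBetti S (2 * 1), IsOfHodgeType 2 S (2 * 1) 2 0 τ → ∃ t : ℂ, τ = t • LinearEquiv.symm η x)) ∧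
        (k3Form x x = 0 ∧ 0 < (k3Form (star x) x).re ∧ ∃ u : K3Index → ℤ,
          k3Form (fun i => (u i : ℂ)) x = 0 ∧ 0 < ∑ i, ∑ j, u i * k3Gram i j * u j)) ∧
      ((∀ a, IsRationalClass a → IsRationalClass (g a)) ∧
        (∀ (i j : ℕ) a, IsOfHodgeType 2 S (2 * 1) i j a → IsOfHodgeType 4 X 2 i j (g a)) ∧
        (∀ d ∈ algebraicClasses S 1, g d = 0) ∧
        (∀ a, ∀ d : complexBetti X 2, d ∈ algebraicClasses X 1 → k3HilbertForm 2 (φ (g a)) (φ d) = 0) ∧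
        (∀ a b, (∀ d ∈ algebraicClasses S 1, cupProduct (rfl : 2 * 1 + 2 * 1 = 2 * 2) a d = 0) →
          (∀ d ∈ algebraicClasses S 1, cupProduct (rfl : 2 * 1 + 2 * 1 = 2 * 2) b d = 0) →
          k3HilbertForm 2 (φ (g a)) (φ (g b)) = k3Form (η a) (η b)) ∧
        (∀ y, (∀ d : complexBetti X 2, d ∈ algebraicClasses X 1 → k3HilbertForm 2 (φ y) (φ d) = 0) →
          ∃ a, (∀ d ∈ algebraicClasses S 1, cupProduct (rfl : 2 * 1 + 2 * 1 = 2 * 2) a d = 0) ∧ g a = y) ∧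
        (∀ y, (∀ d : complexBetti X 2, d ∈ algebraicClasses X 1 → k3HilbertForm 2 (φ y) (φ d) = 0) →
          IsRationalClass y →
          ∃ a, (∀ d ∈ algebraicClasses S 1, cupProduct (rfl : 2 * 1 + 2 * 1 = 2 * 2) a d = 0) ∧
            IsRationalClass a ∧ g a = y)) ∧
      Module.finrank ℂ (algebraicClasses X 1) ≤ Module.finrank ℂ (algebraicClasses S 1) + 1 := by
  obtain ⟨-, hint, -⟩ := id hM
  obtain ⟨NQ, hNQ⟩ := exists_ratNeronSeveri (X := X) φ
  -- `φ v` is a rational vector `v₀ ∈ NQ` with `q(v₀) = -2`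
  obtain ⟨v₀, hv₀⟩ := (isRationalClass_iff_of_markedSq hX hint v).1 hvrat
  have hv₀N : v₀ ∈ NQ := by
    rw [hNQ, ← hv₀, LinearEquiv.symm_apply_apply]
    exact hv
  have hv₀q : qQ v₀ v₀ = -2 := by
    have h := hq
    rw [hv₀, k3HilbertForm_ratCast] at h
    exact_mod_cast h
  obtain ⟨f, hf⟩ := exists_ratTransc_isometry_of_minusTwo hv₀N hv₀q
  exact partnerExistence_of_ratTransc_isometry hP hX hM hNQ f hf

/-- **Every fourfold marked with a period of the form `(x, 0)` has a K3 partner** (mod the surjectivity of the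
K3 period map): the class `δ = φ_H⁻¹(0, 1)` is rational, algebraic (`delta_mem_algebraicClasses`: `(1,1)` by
(m5), Lefschetz `(1,1)`) and `q(δ) = −2`. Applies to Beauville's marked Hilbert squares `(H, φ_H, P_H, (x,0))`
(`Beauville1983_hilbertSquare_markedIncidence`), where of course `S` itself is a partner — recorded as the
non-vacuity check of X3a. [cite: Beauville1983, §6 Prop. 6 and Remarque, §9 Lemme 1 and Rem. 1]
[cite: Huybrechts2016K3, Ch. 6 Thm. 3.1, Ch. 7 Thm. 4.1] -/
theorem exists_k3Partner_of_markedHilbertSquare (hP : Huybrechts_K3_periodSurjective_projective)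
    {H : SchemeOver ℂ} {φH : complexBetti H 2 ≃ₗ[ℂ] (K3HilbertIndex → ℂ)} {PH : complexBetti H (2 * 4)}
    {x : K3Index → ℂ} (hH : IsSmoothProjective 4 H) (hMH : MarkedK3Sq[H, φH, PH, Sum.elim x 0]) :
    ∃ (S : SchemeOver ℂ) (η : complexBetti S (2 * 1) ≃ₗ[ℂ] (K3Index → ℂ)) (p : complexBetti S (2 * 2))
      (x' : K3Index → ℂ) (g : complexBetti S (2 * 1) →ₗ[ℂ] complexBetti H 2),
      IsK3Surface S ∧
      (p ≠ 0 ∧ (IsIntegralClass p ∧ (∀ q : complexBetti S (2 * 2), IsIntegralClass q → ∃ n : ℤ, q = n • p) ∧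
        (∀ c : complexBetti S (2 * 1), IsIntegralClass c ↔ ∃ v : K3Index → ℤ, η c = fun i => (v i : ℂ)) ∧
        (∀ a b : complexBetti S (2 * 1), cupProduct (rfl : 2 * 1 + 2 * 1 = 2 * 2) a b = k3Form (η a) (η b) • p) ∧
        IsOfHodgeType 2 S (2 * 1) 2 0 (LinearEquiv.symm η x') ∧
        (∀ τ : complexBetti S (2 * 1), IsOfHodgeType 2 S (2 * 1) 2 0 τ → ∃ t : ℂ, τ = t • LinearEquiv.symm η x')) ∧
        (k3Form x' x' = 0 ∧ 0 < (k3Form (star x') x').re ∧ ∃ u : K3Index → ℤ,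
          k3Form (fun i => (u i : ℂ)) x' = 0 ∧ 0 < ∑ i, ∑ j, u i * k3Gram i j * u j)) ∧
      ((∀ a, IsRationalClass a → IsRationalClass (g a)) ∧
        (∀ (i j : ℕ) a, IsOfHodgeType 2 S (2 * 1) i j a → IsOfHodgeType 4 H 2 i j (g a)) ∧
        (∀ d ∈ algebraicClasses S 1, g d = 0) ∧
        (∀ a, ∀ d : complexBetti H 2, d ∈ algebraicClasses H 1 → k3HilbertForm 2 (φH (g a)) (φH d) = 0) ∧
        (∀ a b, (∀ d ∈ algebraicClasses S 1, cupProduct (rfl : 2 * 1 + 2 * 1 = 2 * 2) a d = 0) →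
          (∀ d ∈ algebraicClasses S 1, cupProduct (rfl : 2 * 1 + 2 * 1 = 2 * 2) b d = 0) →
          k3HilbertForm 2 (φH (g a)) (φH (g b)) = k3Form (η a) (η b)) ∧
        (∀ y, (∀ d : complexBetti H 2, d ∈ algebraicClasses H 1 → k3HilbertForm 2 (φH y) (φH d) = 0) →
          ∃ a, (∀ d ∈ algebraicClasses S 1, cupProduct (rfl : 2 * 1 + 2 * 1 = 2 * 2) a d = 0) ∧ g a = y) ∧
        (∀ y, (∀ d : complexBetti H 2, d ∈ algebraicClasses H 1 → k3HilbertForm 2 (φH y) (φH d) = 0) →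
          IsRationalClass y →
          ∃ a, (∀ d ∈ algebraicClasses S 1, cupProduct (rfl : 2 * 1 + 2 * 1 = 2 * 2) a d = 0) ∧
            IsRationalClass a ∧ g a = y)) ∧
      Module.finrank ℂ (algebraicClasses H 1) ≤ Module.finrank ℂ (algebraicClasses S 1) + 1 := by
  obtain ⟨-, hintH, -⟩ := id hMH
  refine exists_k3Partner_of_minusTwoClass hP hH hMH (delta_mem_algebraicClasses hH hMH) ?_ ?_
  · exact (isRationalClass_iff_of_markedSq hH hintH _).2
      ⟨Pi.single (Sum.inr ()) 1, by
        rw [LinearEquiv.apply_symm_apply]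
        funext i
        rcases i with k | u
        · simp
        · obtain rfl : u = () := rfl
          simp⟩
  · rw [LinearEquiv.apply_symm_apply, k3HilbertForm_delta_right]
    simp


end Summit.HodgeConjecture.HodgeConjecture.Theorems.MarkmanPartnerTransport.PartnerLattice

end
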